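/-
Copyright: the b2b-balaban T⁴-continuum CRUX team, row NE7b OWNER lineage `t4-ne7b-p1` (gen 122). Project licence.
-/
import Summits.QuantumFields.BalabanUV.T4Continuum.Spine.NE7b.SupTorusVolumeComparisonNextScale

/-!
# THE NEXT ACTION'S HESSIAN `W″ = (n+1)^d T⁻¹` IS VOLUME-INDEPENDENT UP TO `e^{−δs}`: the deck fold is an algebra homomorphism on
# deck-invariant matrices, so (159)'s folding identity passes to the INVERSE — `T_s⁻¹(πc ŷ, πc ŷ′) = Σ_{πc ŷ″ = πc ŷ′} T_{st}⁻¹(ŷ, ŷ″)` EXACTLY —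
# and the far translates cost `≤ c₁·e^{2δρ_{st}(ŷ,ŷ′)}·e^{−δs}·K` by (135)'s entry decay of `T⁻¹`: `|T_{st}⁻¹(ŷ,ŷ′) − T_s⁻¹(πc ŷ, πc ŷ′)| ≤
# C·e^{2δρ_{st}(ŷ,ŷ′)}·e^{−δs}` on the road's two-sided class, every `d`, every mesh.  Deck invariance of `T_{st}` is the translation covariance
# of the displayed action by block-lattice vectors (uniqueness of the block columns) (row NE7b, node U5c; (133)∕(135)∕(138)∕(158)∕(159)
# BY NAME; [folklore])

Cell `pub-balaban`, sub-cell `t4`, spine estimate NE7b (`T4WeightBudget.RelWeightBound`; the cell's OWN estimate — NOT PRINTED in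
[Bałaban 1983–89], NOT PROVED).  Crux-route work under `Spine/NE7b/` by the row OWNER (`t4-ne7b-p1` gen 122, file (160)) under FREEZE
(0)'s crux-prover clause; NOTHING of Bałaban's is named as a Lean object, valued or asserted; no `T4Continuum/Support` leaf typed; no `def`,
no notation (actions, `T`, covering maps DISPLAYED; deck translations are `ŷ ↦ ŷ + σ(s•m)`, `x ↦ x + σ(side n • (s•m))`); zero `sorry`.
Imports (BY NAME): the OWNER's (159) `…SupTorusVolumeComparisonNextScale` (`schur_fold`; through it (158) `cover_eq`, `bt_cover`,
`deck_sum_exp_le`, (138) `schur_det_isUnit`, (135) `nextScale_hessian_local`, (133) `action_injective`, the torus dictionary), Mathlib's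
`Matrix.inv_submatrix_equiv`, `Matrix.mul_nonsing_inv`, `Matrix.inv_eq_right_inv`.

WHY (located).  (159) folds `T`; the road iterates through `W″ = (n+1)^d T⁻¹` ((102)).  `fold(A)·fold(B) = fold(AB)` needs `fold(B)` to be
independent of the representative of the fibre, i.e. `B` DECK-INVARIANT; `T_{st}` is (translation covariance of the displayed action by
`side n • c`, `c = s•m`: blocks go to blocks, `V∘πf` and the block indicators are invariant, so `ψ_{ŷ″+σc}(· + σ(side n • c)) = ψ_{ŷ″}` by
uniqueness — §1), hence so is `T_{st}⁻¹` (`Matrix.inv_submatrix_equiv` with the translation equivalence — §2); then `T_s·fold(T_{st}⁻¹) =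
fold(T_{st}T_{st}⁻¹) = fold(1) = 1`, so `fold(T_{st}⁻¹) = T_s⁻¹` (§2 `inverse_fold`), and §3 subtracts the `ŷ′`-term as in (159).

WHAT IS PROVED ([folklore]; tori and columns as in (159); `c = (s : ℤ)•m`, `m ∈ ℤ^d`):
* §1 `deck_pc`, `deck_pf`, `deck_bt` (deck translations fix `πc`, `πf` and shift `bt`), `action_translate` (translation covariance of the
  displayed action by `σ(side n • c′)`, any `c′ ∈ ℤ^d`), `column_translate` (`ψ_{ŷ″+σc}(x + σ(side n•c)) = ψ_{ŷ″}(x)`), **`schur_translate`**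
  (`T_{st}(ŷ + σc, ŷ″ + σc) = T_{st}(ŷ, ŷ″)`).
* §2 `schurInv_translate` (the same for `T_{st}⁻¹`), `foldInv_indep` (the fold of `T_{st}⁻¹` does not depend on the representative),
  **`inverse_fold`** (`T_s⁻¹(πc ŷ, y′) = Σ_{ŷ″} 𝟙[πc ŷ″ = y′]·T_{st}⁻¹(ŷ, ŷ″)`, two-sided class).
* §3 THE HEADLINE **`nextScale_inverse_volume_comparison`**: `a > 0`, `λ < min(2,a)`, `Λ ≥ 0` ⟹ `∃ C δ > 0`: for ALL `n, s, t`, covering maps,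
  `−λ ≤ V ≤ Λ`, block columns on both tori, all `ŷ, ŷ′`: `|T_{st}⁻¹(ŷ,ŷ′) − T_s⁻¹(πc ŷ, πc ŷ′)| ≤ C·e^{2δρ_{st}(ŷ,ŷ′)}·e^{−δs}`.
* §4 toy.

HONEST (what this is NOT).  Two commensurable tori, not `ℤ^d`; periodic potentials; constants existential; cubic periods; scalar skeleton
((A3), NC-NE7b-α UNRULED); nothing of Bałaban's.  BY-NAME EFFECT ON THE WALL: NONE.  NE7b NOT PRINTED ∕ NOT PROVED; spine PROVED 0∕9;
rung (B)+1 on a FINITE torus — NOT infinite volume, NOT the mass gap, NOT Clay.  HONEST DEPENDENCY: continuum YM on T⁴ ⇐ BetaPertH ∧ nine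
spine estimates (0∕9 proved); BetaPertH ⇐ (D1) ∧ (D4) ∧ CAP+tail; G-an2-4 gates asym, D1 and NE2∕3∕4.
-/

set_option autoImplicit false

noncomputable section

namespace Summit.QuantumFields.BalabanUV.T4Continuum.NE7b.SupTorusVolumeComparisonInverse

open Real
open Literature.MathematicalPhysics.QuantumFieldTheory.Balaban1983to89
open B6QGQLower276 (X e blk B side chart mem_B sum_B sum_B_const card_cube blk_chart)
open Beta (Site siteOf windowMap siteOf_windowMap siteOf_add siteOf_sub)
open SupTorusDirichletForm (chart_add blockOf_siteOf)
open SupTorusDirichletFormCoercive (comp_siteOf_periodic)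
open PeriodicSupTorusCarrier (exists_windowMap_siteOf natCast_mul_smul_eq siteOf_add_smul)
open OneShotChartTorusRowsZd (blk_translate sum_B_translate)
open SupTorusHessianCombesThomas (exists_rate)
open SupTorusActionForm (action_injective)
open SupTorusCoarseFloor (nextScale_hessian_local)
open SupTorusPropagatorLocality (schur_det_isUnit)
open SupTorusVolumeComparison (cover_eq bt_cover deck_sum_exp_le)
open SupTorusVolumeComparisonNextScale (schur_fold)

variable {d : ℕ}

/-! ## §1. Deck translations: the large Schur complement is deck-invariant -/

section Deck

variable (n s t : ℕ) [NeZero s] [NeZero t]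
  (πf : Site d ((n + 1) * (s * t)) → Site d ((n + 1) * s)) (πc : Site d (s * t) → Site d s)
  (hπf : ∀ q : X d, πf (siteOf d ((n + 1) * (s * t)) q) = siteOf d ((n + 1) * s) q)
  (hπc : ∀ b : X d, πc (siteOf d (s * t) b) = siteOf d s b)

omit [NeZero s] [NeZero t] in
include hπc in
/-- Deck translations fix `πc`: `πc(ŷ + σ(s•m)) = πc ŷ`. [folklore] -/
theorem deck_pc [NeZero (s * t)] (m : X d) (ŷ : Site d (s * t)) : πc (ŷ + siteOf d (s * t) ((s : ℤ) • m)) = πc ŷ := by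
  conv_lhs => rw [← siteOf_windowMap d (s * t) ŷ, ← siteOf_add, hπc, siteOf_add_smul]
  rw [← hπc, siteOf_windowMap]

omit [NeZero s] [NeZero t] in
include hπf in
/-- Deck translations fix `πf`: `πf(x + σ(side n • (s•m))) = πf x`. [folklore] -/
theorem deck_pf [NeZero (s * t)] (m : X d) (x : Site d ((n + 1) * (s * t))) :
    πf (x + siteOf d ((n + 1) * (s * t)) (side n • ((s : ℤ) • m))) = πf x := by
  conv_lhs => rw [← siteOf_windowMap d ((n + 1) * (s * t)) x, ← siteOf_add, hπf, ← natCast_mul_smul_eq, siteOf_add_smul]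
  rw [← hπf, siteOf_windowMap]

omit [NeZero s] [NeZero t] in
/-- Block-lattice translations shift the block: `bt(x + σ(side n • c)) = bt x + σ c` (any `c ∈ ℤ^d`). [folklore] -/
theorem deck_bt [NeZero (s * t)] (c : X d) (x : Site d ((n + 1) * (s * t))) :
    siteOf d (s * t) (blk n (windowMap d ((n + 1) * (s * t)) (x + siteOf d ((n + 1) * (s * t)) (side n • c))))
      = siteOf d (s * t) (blk n (windowMap d ((n + 1) * (s * t)) x)) + siteOf d (s * t) c := by
  conv_lhs => rw [← siteOf_windowMap d ((n + 1) * (s * t)) x, ← siteOf_add, blockOf_siteOf, blk_translate, siteOf_add]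

omit [NeZero s] [NeZero t] in
/-- **TRANSLATION COVARIANCE OF THE DISPLAYED ACTION** by block-lattice vectors: for any `g, W` on the fine torus of period `N = (n+1)S` and
`e₀ = σ(side n • c)`, the displayed action of `x ↦ g(x + e₀)` with potential `x ↦ W(x + e₀)` at `x` equals that of `g` with `W` at `x + e₀`
(blocks go to blocks: the block sum transports with `sum_B_translate`). [folklore] -/
theorem action_translate (S : ℕ) [NeZero S] (a : ℝ) (c : X d) (g W : Site d ((n + 1) * S) → ℝ) (x : Site d ((n + 1) * S)) :
    ((n : ℝ) + 1) ^ 2 * ∑ μ, (2 * g (x + siteOf d ((n + 1) * S) (side n • c))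
        - g (x + siteOf d ((n + 1) * S) (e μ) + siteOf d ((n + 1) * S) (side n • c))
        - g (x - siteOf d ((n + 1) * S) (e μ) + siteOf d ((n + 1) * S) (side n • c)))
      + a / ((n : ℝ) + 1) ^ d * ∑ q ∈ B n (blk n (windowMap d ((n + 1) * S) x)), g (siteOf d ((n + 1) * S) q + siteOf d ((n + 1) * S) (side n • c))
      + W (x + siteOf d ((n + 1) * S) (side n • c)) * g (x + siteOf d ((n + 1) * S) (side n • c))
    = ((n : ℝ) + 1) ^ 2 * ∑ μ, (2 * g (x + siteOf d ((n + 1) * S) (side n • c))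
        - g (x + siteOf d ((n + 1) * S) (side n • c) + siteOf d ((n + 1) * S) (e μ))
        - g (x + siteOf d ((n + 1) * S) (side n • c) - siteOf d ((n + 1) * S) (e μ)))
      + a / ((n : ℝ) + 1) ^ d * ∑ q ∈ B n (blk n (windowMap d ((n + 1) * S) (x + siteOf d ((n + 1) * S) (side n • c)))), g (siteOf d ((n + 1) * S) q)
      + W (x + siteOf d ((n + 1) * S) (side n • c)) * g (x + siteOf d ((n + 1) * S) (side n • c)) := by
  have hlap : ∀ μ, g (x + siteOf d ((n + 1) * S) (e μ) + siteOf d ((n + 1) * S) (side n • c))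
        = g (x + siteOf d ((n + 1) * S) (side n • c) + siteOf d ((n + 1) * S) (e μ)) ∧
      g (x - siteOf d ((n + 1) * S) (e μ) + siteOf d ((n + 1) * S) (side n • c))
        = g (x + siteOf d ((n + 1) * S) (side n • c) - siteOf d ((n + 1) * S) (e μ)) := fun μ =>
    ⟨by rw [add_right_comm], by rw [sub_add_eq_add_sub]⟩
  simp only [(hlap _).1, (hlap _).2]
  congr 2
  -- the block term
  set q₀ : X d := windowMap d ((n + 1) * S) x with hq₀
  have hx : x + siteOf d ((n + 1) * S) (side n • c) = siteOf d ((n + 1) * S) (q₀ + side n • c) := by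
    rw [siteOf_add, siteOf_windowMap]
  obtain ⟨m'', hm''⟩ := exists_windowMap_siteOf ((n + 1) * S) (q₀ + side n • c)
  rw [hx, hm'', natCast_mul_smul_eq, blk_translate, blk_translate, sum_B_translate, sum_B_translate]
  refine congrArg _ (Finset.sum_congr rfl fun q _ => ?_)
  rw [comp_siteOf_periodic n S g, siteOf_add]

variable (a : ℝ) (ha : 0 ≤ a) {lam : ℝ} (hm0 : 0 < min 2 a - lam) (V : Site d ((n + 1) * s) → ℝ) (hV : ∀ x, -lam ≤ V x)
  (ψS : Site d (s * t) → Site d ((n + 1) * (s * t)) → ℝ)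
  (hψS : ∀ ŷ' x, ((n : ℝ) + 1) ^ 2 * ∑ μ, (2 * ψS ŷ' x - ψS ŷ' (x + siteOf d ((n + 1) * (s * t)) (e μ))
        - ψS ŷ' (x - siteOf d ((n + 1) * (s * t)) (e μ)))
      + a / ((n : ℝ) + 1) ^ d * ∑ q ∈ B n (blk n (windowMap d ((n + 1) * (s * t)) x)), ψS ŷ' (siteOf d ((n + 1) * (s * t)) q)
      + V (πf x) * ψS ŷ' x
      = if siteOf d (s * t) (blk n (windowMap d ((n + 1) * (s * t)) x)) = ŷ' then 1 else 0)

include hπf ha hm0 hV hψS in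
/-- **THE BLOCK COLUMNS ARE DECK-COVARIANT**: `ψ_{ŷ″ + σc}(x + σ(side n • c)) = ψ_{ŷ″}(x)`, `c = s•m` — both solve `H(·) = 𝟙[bt · = ŷ″]`
(`action_translate`, `deck_pf`, `deck_bt`), uniqueness ((133)). [folklore] -/
theorem column_translate (m : X d) (ŷ'' : Site d (s * t)) :
    (fun x => ψS (ŷ'' + siteOf d (s * t) ((s : ℤ) • m)) (x + siteOf d ((n + 1) * (s * t)) (side n • ((s : ℤ) • m)))) = ψS ŷ'' := by
  classical
  have hW : ∀ x', -lam ≤ V (πf x') := fun x' => hV _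
  refine action_injective n a (s * t) ha hm0 (fun x' => V (πf x')) hW _ _ fun x => ?_
  have hcov := action_translate n (s * t) a ((s : ℤ) • m) (ψS (ŷ'' + siteOf d (s * t) ((s : ℤ) • m))) (fun x' => V (πf x')) x
  have hVe : V (πf (x + siteOf d ((n + 1) * (s * t)) (side n • ((s : ℤ) • m)))) = V (πf x) := by rw [deck_pf n s t πf hπf m x]
  have h1 := hψS (ŷ'' + siteOf d (s * t) ((s : ℤ) • m)) (x + siteOf d ((n + 1) * (s * t)) (side n • ((s : ℤ) • m)))
  rw [hVe] at h1
  simp only [hVe] at hcov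
  rw [hcov, h1, hψS ŷ'' x, deck_bt n s t ((s : ℤ) • m) x]
  simp only [add_left_inj]

include hπf ha hm0 hV hψS in
/-- **THE LARGE SCHUR COMPLEMENT IS DECK-INVARIANT**: `T_{st}(ŷ + σc, ŷ″ + σc) = T_{st}(ŷ, ŷ″)`, `c = s•m`. [folklore] -/
theorem schur_translate (m : X d) (ŷ ŷ'' : Site d (s * t)) :
    (((n : ℝ) + 1) ^ d)⁻¹ * ∑ z : Fin d → Fin (n + 1), ψS (ŷ'' + siteOf d (s * t) ((s : ℤ) • m))
        (siteOf d ((n + 1) * (s * t)) (chart n (windowMap d (s * t) (ŷ + siteOf d (s * t) ((s : ℤ) • m))) z))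
      = (((n : ℝ) + 1) ^ d)⁻¹ * ∑ z : Fin d → Fin (n + 1), ψS ŷ'' (siteOf d ((n + 1) * (s * t)) (chart n (windowMap d (s * t) ŷ) z)) := by
  have hcol := column_translate n s t πf hπf a ha hm0 V hV ψS hψS m ŷ''
  have hŷ : ŷ + siteOf d (s * t) ((s : ℤ) • m) = siteOf d (s * t) (windowMap d (s * t) ŷ + (s : ℤ) • m) := by
    rw [siteOf_add, siteOf_windowMap]
  obtain ⟨m'', hm''⟩ := exists_windowMap_siteOf (s * t) (windowMap d (s * t) ŷ + (s : ℤ) • m)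
  congr 1
  refine Finset.sum_congr rfl fun z _ => ?_
  rw [hŷ, hm'', chart_add, chart_add,
    comp_siteOf_periodic n (s * t) (ψS (ŷ'' + siteOf d (s * t) ((s : ℤ) • m))) (chart n (windowMap d (s * t) ŷ) z + side n • ((s : ℤ) • m)) m'',
    siteOf_add]
  exact congrFun hcol _

end Deck

/-! ## §2. The inverse folds -/

section Fold

variable (n : ℕ) (a : ℝ) (s t : ℕ) [NeZero s] [NeZero t]
  (πf : Site d ((n + 1) * (s * t)) → Site d ((n + 1) * s)) (πc : Site d (s * t) → Site d s)
  (hπf : ∀ q : X d, πf (siteOf d ((n + 1) * (s * t)) q) = siteOf d ((n + 1) * s) q)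
  (hπc : ∀ b : X d, πc (siteOf d (s * t) b) = siteOf d s b)
  (ha : 0 < a) {lam Lam : ℝ} (hlam : lam < min 2 a) (hLam : 0 ≤ Lam) (V : Site d ((n + 1) * s) → ℝ) (hV : ∀ x, -lam ≤ V x)
  (hV' : ∀ x, V x ≤ Lam)
  (ψs : Site d s → Site d ((n + 1) * s) → ℝ)
  (hψs : ∀ y' x, ((n : ℝ) + 1) ^ 2 * ∑ μ, (2 * ψs y' x - ψs y' (x + siteOf d ((n + 1) * s) (e μ)) - ψs y' (x - siteOf d ((n + 1) * s) (e μ)))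
      + a / ((n : ℝ) + 1) ^ d * ∑ q ∈ B n (blk n (windowMap d ((n + 1) * s) x)), ψs y' (siteOf d ((n + 1) * s) q) + V x * ψs y' x
      = if siteOf d s (blk n (windowMap d ((n + 1) * s) x)) = y' then 1 else 0)
  (ψS : Site d (s * t) → Site d ((n + 1) * (s * t)) → ℝ)
  (hψS : ∀ ŷ' x, ((n : ℝ) + 1) ^ 2 * ∑ μ, (2 * ψS ŷ' x - ψS ŷ' (x + siteOf d ((n + 1) * (s * t)) (e μ))
        - ψS ŷ' (x - siteOf d ((n + 1) * (s * t)) (e μ)))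
      + a / ((n : ℝ) + 1) ^ d * ∑ q ∈ B n (blk n (windowMap d ((n + 1) * (s * t)) x)), ψS ŷ' (siteOf d ((n + 1) * (s * t)) q)
      + V (πf x) * ψS ŷ' x
      = if siteOf d (s * t) (blk n (windowMap d ((n + 1) * (s * t)) x)) = ŷ' then 1 else 0)

include hπf ha hlam hV hψS in
/-- **THE INVERSE OF THE LARGE SCHUR COMPLEMENT IS DECK-INVARIANT** (`Matrix.inv_submatrix_equiv` with the translation by `σc`). [folklore] -/
theorem schurInv_translate (m : X d) (ŷ ŷ'' : Site d (s * t)) :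
    (Matrix.of fun yy y'' : Site d (s * t) =>
        (((n : ℝ) + 1) ^ d)⁻¹ * ∑ z : Fin d → Fin (n + 1), ψS y'' (siteOf d ((n + 1) * (s * t)) (chart n (windowMap d (s * t) yy) z)))⁻¹
        (ŷ + siteOf d (s * t) ((s : ℤ) • m)) (ŷ'' + siteOf d (s * t) ((s : ℤ) • m))
      = (Matrix.of fun yy y'' : Site d (s * t) =>
        (((n : ℝ) + 1) ^ d)⁻¹ * ∑ z : Fin d → Fin (n + 1), ψS y'' (siteOf d ((n + 1) * (s * t)) (chart n (windowMap d (s * t) yy) z)))⁻¹ ŷ ŷ'' := by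
  classical
  set T : Matrix (Site d (s * t)) (Site d (s * t)) ℝ := Matrix.of fun yy y'' : Site d (s * t) =>
    (((n : ℝ) + 1) ^ d)⁻¹ * ∑ z : Fin d → Fin (n + 1), ψS y'' (siteOf d ((n + 1) * (s * t)) (chart n (windowMap d (s * t) yy) z)) with hT_def
  have hm0 : 0 < min 2 a - lam := by linarith
  have hinv : T.submatrix (Equiv.addRight (siteOf d (s * t) ((s : ℤ) • m))) (Equiv.addRight (siteOf d (s * t) ((s : ℤ) • m))) = T := by
    ext yy y''
    rw [Matrix.submatrix_apply]
    exact schur_translate n s t πf hπf a ha.le hm0 V hV ψS hψS m yy y''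
  have h := Matrix.inv_submatrix_equiv T (Equiv.addRight (siteOf d (s * t) ((s : ℤ) • m))) (Equiv.addRight (siteOf d (s * t) ((s : ℤ) • m)))
  rw [hinv] at h
  have h2 : T⁻¹.submatrix (Equiv.addRight (siteOf d (s * t) ((s : ℤ) • m))) (Equiv.addRight (siteOf d (s * t) ((s : ℤ) • m))) ŷ ŷ''
      = T⁻¹ ŷ ŷ'' := by rw [← h]
  rw [Matrix.submatrix_apply] at h2
  exact h2

include hπf hπc ha hlam hV hψS in
/-- **THE FOLD OF `T_{st}⁻¹` DOES NOT DEPEND ON THE REPRESENTATIVE**: `πc ŷ = πc ŷ₁` ⟹ `Σ_{ŷ″} 𝟙[πc ŷ″ = y′]·T⁻¹(ŷ, ŷ″) = Σ_{ŷ″} 𝟙[πc ŷ″ = y′]·T⁻¹(ŷ₁, ŷ″)`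
(the two representatives differ by a deck translation; reindex the sum by it). [folklore] -/
theorem foldInv_indep (ŷ ŷ₁ : Site d (s * t)) (hrep : πc ŷ = πc ŷ₁) (y' : Site d s) :
    ∑ ŷ'' : Site d (s * t), (if πc ŷ'' = y' then (1 : ℝ) else 0) * (Matrix.of fun yy y'' : Site d (s * t) =>
        (((n : ℝ) + 1) ^ d)⁻¹ * ∑ z : Fin d → Fin (n + 1), ψS y'' (siteOf d ((n + 1) * (s * t)) (chart n (windowMap d (s * t) yy) z)))⁻¹ ŷ ŷ''
      = ∑ ŷ'' : Site d (s * t), (if πc ŷ'' = y' then (1 : ℝ) else 0) * (Matrix.of fun yy y'' : Site d (s * t) =>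
        (((n : ℝ) + 1) ^ d)⁻¹ * ∑ z : Fin d → Fin (n + 1), ψS y'' (siteOf d ((n + 1) * (s * t)) (chart n (windowMap d (s * t) yy) z)))⁻¹ ŷ₁ ŷ'' := by
  classical
  -- the representatives differ by `σ(s•m)`
  set b : X d := windowMap d (s * t) ŷ with hb
  set b₁ : X d := windowMap d (s * t) ŷ₁ with hb₁
  have hdvd : ∀ i, (s : ℤ) ∣ b i - b₁ i := fun i => by
    have h1 : siteOf d s b = siteOf d s b₁ := by rw [← hπc b, ← hπc b₁, hb, hb₁, siteOf_windowMap, siteOf_windowMap, hrep]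
    exact (ZMod.intCast_eq_intCast_iff_dvd_sub (b₁ i) (b i) s).1 (congrFun h1 i).symm
  choose mv hmv using hdvd
  have hŷ : ŷ = ŷ₁ + siteOf d (s * t) ((s : ℤ) • (fun i => mv i)) := by
    have : b = b₁ + (s : ℤ) • (fun i => mv i) := by
      funext i; simp only [Pi.add_apply, Pi.smul_apply, smul_eq_mul]; linarith [hmv i]
    rw [← siteOf_windowMap d (s * t) ŷ, ← siteOf_windowMap d (s * t) ŷ₁, ← hb, ← hb₁, this, siteOf_add]
  rw [hŷ]
  refine (Fintype.sum_equiv (Equiv.addRight (siteOf d (s * t) ((s : ℤ) • (fun i => mv i)))) _ _ fun ŷ'' => ?_).symm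
  rw [Equiv.coe_addRight, deck_pc s t πc hπc (fun i => mv i) ŷ'',
    schurInv_translate n a s t πf hπf ha hlam V hV ψS hψS (fun i => mv i) ŷ₁ ŷ'']

include hπf hπc ha hlam hLam hV hV' hψs hψS in
/-- **THE INVERSE FOLDING IDENTITY**: on the two-sided class, `T_s⁻¹(πc ŷ, y′) = Σ_{ŷ″} 𝟙[πc ŷ″ = y′]·T_{st}⁻¹(ŷ, ŷ″)` for every large block `ŷ`
and small block `y′` — `T_s·fold(T_{st}⁻¹) = fold(T_{st}·T_{st}⁻¹) = 1` ((159) `schur_fold`, `foldInv_indep`, (138) `schur_det_isUnit`),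
`Matrix.inv_eq_right_inv`. [folklore] -/
theorem inverse_fold (ŷ : Site d (s * t)) (y' : Site d s) :
    (Matrix.of fun yy y'' : Site d s =>
        (((n : ℝ) + 1) ^ d)⁻¹ * ∑ z : Fin d → Fin (n + 1), ψs y'' (siteOf d ((n + 1) * s) (chart n (windowMap d s yy) z)))⁻¹ (πc ŷ) y'
      = ∑ ŷ'' : Site d (s * t), (if πc ŷ'' = y' then (1 : ℝ) else 0) * (Matrix.of fun yy y'' : Site d (s * t) =>
        (((n : ℝ) + 1) ^ d)⁻¹ * ∑ z : Fin d → Fin (n + 1), ψS y'' (siteOf d ((n + 1) * (s * t)) (chart n (windowMap d (s * t) yy) z)))⁻¹ ŷ ŷ'' := by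
  classical
  have hm0 : 0 < min 2 a - lam := by linarith
  have hW : ∀ x', -lam ≤ V (πf x') := fun x' => hV _
  have hW' : ∀ x', V (πf x') ≤ Lam := fun x' => hV' _
  set Ts : Matrix (Site d s) (Site d s) ℝ := Matrix.of fun yy y'' : Site d s =>
    (((n : ℝ) + 1) ^ d)⁻¹ * ∑ z : Fin d → Fin (n + 1), ψs y'' (siteOf d ((n + 1) * s) (chart n (windowMap d s yy) z)) with hTs_def
  set TS : Matrix (Site d (s * t)) (Site d (s * t)) ℝ := Matrix.of fun yy y'' : Site d (s * t) =>
    (((n : ℝ) + 1) ^ d)⁻¹ * ∑ z : Fin d → Fin (n + 1), ψS y'' (siteOf d ((n + 1) * (s * t)) (chart n (windowMap d (s * t) yy) z)) with hTS_def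
  -- the canonical lift `L y = σ(wm y)` and the folded inverse
  have hL : ∀ y : Site d s, πc (siteOf d (s * t) (windowMap d s y)) = y := fun y => by rw [hπc, siteOf_windowMap]
  set F : Matrix (Site d s) (Site d s) ℝ := Matrix.of fun y y'' : Site d s =>
    ∑ ŷ'' : Site d (s * t), (if πc ŷ'' = y'' then (1 : ℝ) else 0) * TS⁻¹ (siteOf d (s * t) (windowMap d s y)) ŷ'' with hF_def
  have hTSunit := schur_det_isUnit n a (s * t) ha hlam hLam (fun x' => V (πf x')) hW hW' ψS hψS
  have hmulS : TS * TS⁻¹ = 1 := Matrix.mul_nonsing_inv _ hTSunit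
  -- `Ts * F = 1`
  have hmul : Ts * F = 1 := by
    ext y y''
    rw [Matrix.mul_apply]
    have hfold : ∀ y_m : Site d s, Ts y y_m = ∑ ŷ_m : Site d (s * t), (if πc ŷ_m = y_m then (1 : ℝ) else 0) * TS (siteOf d (s * t) (windowMap d s y)) ŷ_m := by
      intro y_m
      have h := schur_fold n a s t πf πc hπf hπc ha.le hm0 V hV ψs hψs ψS hψS (siteOf d (s * t) (windowMap d s y)) y_m
      rw [hL y] at h
      exact h
    have hFrep : ∀ ŷ_m : Site d (s * t), F (πc ŷ_m) y'' = ∑ ŷ'' : Site d (s * t), (if πc ŷ'' = y'' then (1 : ℝ) else 0) * TS⁻¹ ŷ_m ŷ'' := by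
      intro ŷ_m
      simp only [hF_def, Matrix.of_apply]
      exact foldInv_indep n a s t πf πc hπf hπc ha hlam V hV ψS hψS _ ŷ_m (hL (πc ŷ_m)) y''
    calc ∑ y_m, Ts y y_m * F y_m y''
        = ∑ y_m, ∑ ŷ_m : Site d (s * t), (if πc ŷ_m = y_m then (1 : ℝ) else 0) * (TS (siteOf d (s * t) (windowMap d s y)) ŷ_m * F y_m y'') := by
          refine Finset.sum_congr rfl fun y_m _ => ?_
          rw [hfold y_m, Finset.sum_mul]
          exact Finset.sum_congr rfl fun ŷ_m _ => by ring
      _ = ∑ ŷ_m : Site d (s * t), TS (siteOf d (s * t) (windowMap d s y)) ŷ_m * F (πc ŷ_m) y'' := by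
          rw [Finset.sum_comm]
          refine Finset.sum_congr rfl fun ŷ_m _ => ?_
          simp only [ite_mul, one_mul, zero_mul, Finset.sum_ite_eq, Finset.mem_univ, if_true]
      _ = ∑ ŷ_m : Site d (s * t), ∑ ŷ'' : Site d (s * t), (if πc ŷ'' = y'' then (1 : ℝ) else 0)
            * (TS (siteOf d (s * t) (windowMap d s y)) ŷ_m * TS⁻¹ ŷ_m ŷ'') := by
          refine Finset.sum_congr rfl fun ŷ_m _ => ?_
          rw [hFrep ŷ_m, Finset.mul_sum]
          exact Finset.sum_congr rfl fun ŷ'' _ => by ring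
      _ = ∑ ŷ'' : Site d (s * t), (if πc ŷ'' = y'' then (1 : ℝ) else 0) * (TS * TS⁻¹) (siteOf d (s * t) (windowMap d s y)) ŷ'' := by
          rw [Finset.sum_comm]
          refine Finset.sum_congr rfl fun ŷ'' _ => ?_
          rw [Matrix.mul_apply, Finset.mul_sum]
      _ = (1 : Matrix (Site d s) (Site d s) ℝ) y y'' := by
          rw [hmulS]
          simp only [Matrix.one_apply, mul_ite, mul_one, mul_zero, Finset.sum_ite_eq, Finset.mem_univ, if_true]
          by_cases hy : y = y''
          · rw [if_pos hy, if_pos ((hL y).trans hy)]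
          · rw [if_neg hy, if_neg (fun h => hy ((hL y).symm.trans h))]
  have hinv : Ts⁻¹ = F := Matrix.inv_eq_right_inv hmul
  rw [hinv]
  simp only [hF_def, Matrix.of_apply]
  exact foldInv_indep n a s t πf πc hπf hπc ha hlam V hV ψS hψS _ ŷ (hL (πc ŷ)) y'

end Fold

/-! ## §3. THE END: the inverses agree up to `e^{−δs}` -/

/-- **HEADLINE — VOLUME INDEPENDENCE OF `T⁻¹` (HENCE OF THE NEXT ACTION'S HESSIAN `(n+1)^d T⁻¹`) UP TO `e^{−δs}`, every `d`, every mesh, two-sided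
class.**  `∃ C δ > 0` (from `(d, a, λ, Λ)`) such that for ALL `n, s, t`, covering maps, small potentials `−λ ≤ V ≤ Λ`, block columns on both tori
and all `ŷ, ŷ′`: `|T_{st}⁻¹(ŷ,ŷ′) − T_s⁻¹(πc ŷ, πc ŷ′)| ≤ C·e^{2δρ_{st}(ŷ,ŷ′)}·e^{−δs}` (§2 `inverse_fold` at `y′ = πc ŷ′`, the far translates by
(135) `nextScale_hessian_local` and (158) `deck_sum_exp_le`). [folklore] -/
theorem nextScale_inverse_volume_comparison (a : ℝ) (ha : 0 < a) {lam Lam : ℝ} (hlam : lam < min 2 a) (hLam : 0 ≤ Lam) :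
    ∃ C δ : ℝ, 0 < C ∧ 0 < δ ∧ ∀ (n s t : ℕ) [NeZero s] [NeZero t]
      (πf : Site d ((n + 1) * (s * t)) → Site d ((n + 1) * s)) (πc : Site d (s * t) → Site d s),
      (∀ q : X d, πf (siteOf d ((n + 1) * (s * t)) q) = siteOf d ((n + 1) * s) q) →
      (∀ b : X d, πc (siteOf d (s * t) b) = siteOf d s b) →
      ∀ (V : Site d ((n + 1) * s) → ℝ), (∀ x, -lam ≤ V x) → (∀ x, V x ≤ Lam) →
      ∀ ψs : Site d s → Site d ((n + 1) * s) → ℝ,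
      (∀ y' x, ((n : ℝ) + 1) ^ 2 * ∑ μ, (2 * ψs y' x - ψs y' (x + siteOf d ((n + 1) * s) (e μ)) - ψs y' (x - siteOf d ((n + 1) * s) (e μ)))
        + a / ((n : ℝ) + 1) ^ d * ∑ q ∈ B n (blk n (windowMap d ((n + 1) * s) x)), ψs y' (siteOf d ((n + 1) * s) q) + V x * ψs y' x
        = if siteOf d s (blk n (windowMap d ((n + 1) * s) x)) = y' then 1 else 0) →
      ∀ ψS : Site d (s * t) → Site d ((n + 1) * (s * t)) → ℝ,
      (∀ ŷ' x, ((n : ℝ) + 1) ^ 2 * ∑ μ, (2 * ψS ŷ' x - ψS ŷ' (x + siteOf d ((n + 1) * (s * t)) (e μ))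
          - ψS ŷ' (x - siteOf d ((n + 1) * (s * t)) (e μ)))
        + a / ((n : ℝ) + 1) ^ d * ∑ q ∈ B n (blk n (windowMap d ((n + 1) * (s * t)) x)), ψS ŷ' (siteOf d ((n + 1) * (s * t)) q)
        + V (πf x) * ψS ŷ' x
        = if siteOf d (s * t) (blk n (windowMap d ((n + 1) * (s * t)) x)) = ŷ' then 1 else 0) →
      ∀ ŷ ŷ' : Site d (s * t),
        |(Matrix.of fun yy y'' : Site d (s * t) =>
            (((n : ℝ) + 1) ^ d)⁻¹ * ∑ z : Fin d → Fin (n + 1), ψS y'' (siteOf d ((n + 1) * (s * t)) (chart n (windowMap d (s * t) yy) z)))⁻¹ ŷ ŷ'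
          - (Matrix.of fun yy y'' : Site d s =>
            (((n : ℝ) + 1) ^ d)⁻¹ * ∑ z : Fin d → Fin (n + 1), ψs y'' (siteOf d ((n + 1) * s) (chart n (windowMap d s yy) z)))⁻¹ (πc ŷ) (πc ŷ')|
          ≤ C * exp (2 * δ * ∑ i, (((ŷ i - ŷ' i).valMinAbs.natAbs : ℕ) : ℝ)) * exp (-(δ * s)) := by
  classical
  have hm0 : 0 < min 2 a - lam := by linarith
  obtain ⟨c₁, δ₁, hc₁, hδ₁, H135⟩ := nextScale_hessian_local (d := d) a ha hm0 hLam
  set δ : ℝ := δ₁ / 2 with hδ_def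
  have hδ0 : 0 < δ := by positivity
  set K : ℝ := (2 * (1 - exp (-δ))⁻¹) ^ d with hK
  have hK0 : 0 ≤ K := pow_nonneg (mul_nonneg zero_le_two (inv_nonneg.2 (sub_nonneg.2 (exp_le_one_iff.2 (by linarith))))) d
  refine ⟨c₁ * K + 1, δ, by positivity, hδ0, ?_⟩
  intro n s t _ _ πf πc hπf hπc V hV hV' ψs hψs ψS hψS ŷ ŷ'
  have hW : ∀ x', -lam ≤ V (πf x') := fun x' => hV _
  have hW' : ∀ x', V (πf x') ≤ Lam := fun x' => hV' _
  set TS : Matrix (Site d (s * t)) (Site d (s * t)) ℝ := Matrix.of fun yy y'' : Site d (s * t) =>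
    (((n : ℝ) + 1) ^ d)⁻¹ * ∑ z : Fin d → Fin (n + 1), ψS y'' (siteOf d ((n + 1) * (s * t)) (chart n (windowMap d (s * t) yy) z)) with hTS_def
  have hT : ∀ ŷ'' : Site d (s * t), |TS⁻¹ ŷ ŷ''| ≤ c₁ * exp (-(δ₁ * ∑ i, (((ŷ i - ŷ'' i).valMinAbs.natAbs : ℕ) : ℝ))) :=
    fun ŷ'' => H135 n (s * t) (fun x' => V (πf x')) hW hW' ψS hψS ŷ ŷ''
  have hfold := inverse_fold n a s t πf πc hπf hπc ha hlam hLam V hV hV' ψs hψs ψS hψS ŷ (πc ŷ')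
  have hsplit : ∑ ŷ'' : Site d (s * t), (if πc ŷ'' = πc ŷ' then (1 : ℝ) else 0) * TS⁻¹ ŷ ŷ''
      = TS⁻¹ ŷ ŷ' + ∑ ŷ'' : Site d (s * t), (if ŷ'' ≠ ŷ' ∧ πc ŷ'' = πc ŷ' then (1 : ℝ) else 0) * TS⁻¹ ŷ ŷ'' := by
    rw [← Finset.add_sum_erase Finset.univ _ (Finset.mem_univ ŷ'), if_pos rfl, one_mul,
      ← Finset.add_sum_erase Finset.univ (fun ŷ'' => (if ŷ'' ≠ ŷ' ∧ πc ŷ'' = πc ŷ' then (1 : ℝ) else 0) * TS⁻¹ ŷ ŷ'') (Finset.mem_univ ŷ')]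
    simp only [ne_eq, not_true_eq_false, false_and, if_false, zero_mul, zero_add]
    congr 1
    exact Finset.sum_congr rfl fun ŷ'' hŷ => by rw [Finset.mem_erase] at hŷ; simp only [hŷ.1, not_false_eq_true, true_and]
  have hdiff : TS⁻¹ ŷ ŷ' - (Matrix.of fun yy y'' : Site d s =>
        (((n : ℝ) + 1) ^ d)⁻¹ * ∑ z : Fin d → Fin (n + 1), ψs y'' (siteOf d ((n + 1) * s) (chart n (windowMap d s yy) z)))⁻¹ (πc ŷ) (πc ŷ')
      = -∑ ŷ'' : Site d (s * t), (if ŷ'' ≠ ŷ' ∧ πc ŷ'' = πc ŷ' then (1 : ℝ) else 0) * TS⁻¹ ŷ ŷ'' := by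
    rw [hfold, hsplit]; ring
  rw [hdiff, abs_neg]
  calc |∑ ŷ'' : Site d (s * t), (if ŷ'' ≠ ŷ' ∧ πc ŷ'' = πc ŷ' then (1 : ℝ) else 0) * TS⁻¹ ŷ ŷ''|
      ≤ ∑ ŷ'' : Site d (s * t), |(if ŷ'' ≠ ŷ' ∧ πc ŷ'' = πc ŷ' then (1 : ℝ) else 0) * TS⁻¹ ŷ ŷ''| := Finset.abs_sum_le_sum_abs _ _
    _ ≤ ∑ ŷ'' : Site d (s * t), c₁ * (if ŷ'' ≠ ŷ' ∧ πc ŷ'' = πc ŷ' then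
          exp (-(2 * δ * ∑ i, (((ŷ i - ŷ'' i).valMinAbs.natAbs : ℕ) : ℝ))) else 0) := by
        refine Finset.sum_le_sum fun ŷ'' _ => ?_
        split_ifs with h
        · rw [one_mul, show 2 * δ = δ₁ by rw [hδ_def]; ring]; exact hT ŷ''
        · rw [zero_mul, abs_zero, mul_zero]
    _ = c₁ * ∑ ŷ'' : Site d (s * t), (if ŷ'' ≠ ŷ' ∧ πc ŷ'' = πc ŷ' then
          exp (-(2 * δ * ∑ i, (((ŷ i - ŷ'' i).valMinAbs.natAbs : ℕ) : ℝ))) else 0) := (Finset.mul_sum _ _ _).symm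
    _ ≤ c₁ * (exp (2 * δ * ∑ i, (((ŷ i - ŷ' i).valMinAbs.natAbs : ℕ) : ℝ)) * exp (-(δ * s)) * K) :=
        mul_le_mul_of_nonneg_left (deck_sum_exp_le s t πc hπc hδ0 ŷ' ŷ) hc₁.le
    _ = (c₁ * K) * exp (2 * δ * ∑ i, (((ŷ i - ŷ' i).valMinAbs.natAbs : ℕ) : ℝ)) * exp (-(δ * s)) := by ring
    _ ≤ (c₁ * K + 1) * exp (2 * δ * ∑ i, (((ŷ i - ŷ' i).valMinAbs.natAbs : ℕ) : ℝ)) * exp (-(δ * s)) := by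
        have : (0 : ℝ) ≤ exp (2 * δ * ∑ i, (((ŷ i - ŷ' i).valMinAbs.natAbs : ℕ) : ℝ)) * exp (-(δ * s)) := by positivity
        nlinarith

/-! ## §4. Toy -/

/-- Toy (`d = 0`, `a = 1`, `λ = 0`, `Λ = 1`): the constants exist. -/
example : ∃ C δ : ℝ, 0 < C ∧ 0 < δ :=
  let ⟨C, δ, hC, hδ, _⟩ := nextScale_inverse_volume_comparison (d := 0) 1 one_pos (lam := 0) (Lam := 1) (by norm_num) zero_le_one
  ⟨C, δ, hC, hδ⟩

end Summit.QuantumFields.BalabanUV.T4Continuum.NE7b.SupTorusVolumeComparisonInverse
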